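import Summits.HubbardSuperconductivity.HubbardSuperconductivity.Theorems.AnisotropyChordTowerBridge

/-!
# Route `AnisotropyChord` / H0 rotor rung: PARTICLE–HOLE CONJUGATION of Perron sector amplitudes — the global spin flip
# maps the Perron amplitude of the sector `M` to that of `−M` and preserves the complete-graph (spin-deficit) form
# (work-order v13(e), case `M' = −M`, of theory seat `hubbard-h0-rotor-theory-1`, memo ROTOR-THEORY-11 §161 (e))

* `flipAll σ = 1 − σ` (sitewise), an involution; `zerosCard_flipAll`, `isingW_flipAll`, `fmOp_comp_flipAll`, `sum_flipAll`;
* `mem_spinZSector_of_support` : a real amplitude supported on `zerosCard = |V|/2 + M` lies in the sector `M`;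
* **`isPerron_flipAll`** : `IsPerron… L Δ M a ∧ (sector −M carries a Perron amplitude) ⇒ IsPerron… L Δ (−M) (a ∘ flipAll)`
  (`E(−M) = E(M)` by Rayleigh–Ritz both ways, `…TowerBridge`), hence **`perron_neg_eq_flip`** : the Perron amplitude of
  `−M` IS `a ∘ flipAll` (uniqueness), and **`inner_fmOp_flipAll`** : `⟨a∘flip, B (a∘flip)⟩ = ⟨a, B a⟩` for every graph form.
-/

set_option linter.dupNamespace false
set_option autoImplicit false

noncomputable section

open Finset Matrix
open Summit.HubbardSuperconductivity.HubbardSuperconductivity.Theorems.AnisotropyChord.InsertionEntropy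
open Literature.MathematicalPhysics.QuantumLattice Literature.Probability.LatticeModels

namespace Summit.HubbardSuperconductivity.HubbardSuperconductivity.Theorems.AnisotropyChord.Tower

variable {V : Type} [Fintype V] [DecidableEq V]

/-- Every element of `Fin 2` is `0` or `1`. [folklore] -/
private theorem fin2_cases₃ (i : Fin 2) : i = 0 ∨ i = 1 := by
  rcases i with ⟨_ | _ | k, hk⟩
  · left; rfl
  · right; rfl
  · omega

/-! ### The global spin flip -/

/-- The global spin flip / particle–hole conjugation `σ ↦ 1 − σ`. [folklore] -/
def flipAll (σ : V → Fin 2) : V → Fin 2 := fun x => 1 - σ x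

omit [Fintype V] [DecidableEq V] in
/-- `flipAll` is an involution. [folklore] -/
@[simp] theorem flipAll_flipAll (σ : V → Fin 2) : flipAll (flipAll σ) = σ := by
  funext x; unfold flipAll; rcases fin2_cases₃ (σ x) with h | h <;> simp [h]

omit [Fintype V] [DecidableEq V] in
/-- `(flipAll σ) x = 0 ↔ σ x = 1`. [folklore] -/
theorem flipAll_eq_zero_iff (σ : V → Fin 2) (x : V) : flipAll σ x = 0 ↔ σ x = 1 := by
  unfold flipAll; rcases fin2_cases₃ (σ x) with h | h <;> simp [h]

omit [Fintype V] [DecidableEq V] in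
/-- `(flipAll σ) x = (flipAll σ) y ↔ σ x = σ y`. [folklore] -/
theorem flipAll_eq_iff (σ : V → Fin 2) (x y : V) : flipAll σ x = flipAll σ y ↔ σ x = σ y := by
  unfold flipAll
  rcases fin2_cases₃ (σ x) with hx | hx <;> rcases fin2_cases₃ (σ y) with hy | hy <;> simp [hx, hy]

omit [Fintype V] in
/-- The flip commutes with relabellings. [folklore] -/
theorem flipAll_comp_swap (σ : V → Fin 2) (x y : V) :
    flipAll (σ ∘ ⇑(Equiv.swap x y)) = (flipAll σ) ∘ ⇑(Equiv.swap x y) := rfl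

/-- The flip as an equivalence of configurations. [folklore] -/
def flipAllEquiv : (V → Fin 2) ≃ (V → Fin 2) := ⟨flipAll, flipAll, flipAll_flipAll, flipAll_flipAll⟩

/-- Re-indexing a configuration sum along the flip. [folklore] -/
theorem sum_flipAll {β : Type} [AddCommMonoid β] (F : (V → Fin 2) → β) : ∑ σ, F (flipAll σ) = ∑ σ, F σ :=
  Equiv.sum_comp flipAllEquiv F

omit [DecidableEq V] in
/-- `zerosCard (flipAll σ) = |V| − zerosCard σ`. [folklore] -/
theorem zerosCard_flipAll (σ : V → Fin 2) : zerosCard (flipAll σ) = (Fintype.card V : ℝ) - zerosCard σ := by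
  unfold zerosCard
  have h := Finset.card_filter_add_card_filter_not (s := (univ : Finset V)) (fun x => σ x = 0)
  have hflip : (univ.filter fun x => flipAll σ x = 0) = univ.filter fun x => ¬ σ x = 0 := by
    ext x; simp only [Finset.mem_filter, Finset.mem_univ, true_and, flipAll_eq_zero_iff]
    rcases fin2_cases₃ (σ x) with hx | hx <;> simp [hx]
  rw [hflip, Finset.card_univ] at *
  have := congrArg (fun n : ℕ => (n : ℝ)) h; push_cast at this; linarith

variable (G : SimpleGraph V) [DecidableRel G.Adj]

omit [DecidableEq V] in
/-- The Ising bond sum is flip-invariant. [folklore] -/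
theorem isingW_flipAll (σ : V → Fin 2) : isingW G (flipAll σ) = isingW G σ := by
  unfold isingW; simp only [flipAll_eq_iff]

/-- The transposition form commutes with the flip: `(A (b ∘ flip))(σ) = (A b)(flip σ)`. [folklore] -/
theorem fmOp_comp_flipAll (b : (V → Fin 2) → ℝ) (σ : V → Fin 2) :
    fmOp G (b ∘ flipAll) σ = fmOp G b (flipAll σ) := by
  unfold fmOp; simp only [Function.comp_apply, flipAll_comp_swap]

/-- **The graph forms are flip-invariant:** `⟨b∘flip, A (b∘flip)⟩ = ⟨b, A b⟩`. [folklore] -/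
theorem inner_fmOp_flipAll (b : (V → Fin 2) → ℝ) :
    ∑ σ, (b ∘ flipAll) σ * fmOp G (b ∘ flipAll) σ = ∑ σ, b σ * fmOp G b σ := by
  simp_rw [fmOp_comp_flipAll, Function.comp_apply]
  exact sum_flipAll (fun τ => b τ * fmOp G b τ)

/-! ### On the torus -/

section Torus

variable {L : ℕ} [NeZero L]

/-- A real amplitude supported on `zerosCard = |V|/2 + M` lies (read in `ℂ`) in the sector `Sᶻ_tot = M`. [folklore] -/
theorem mem_spinZSector_of_support (M : ℝ) (b : TensorIndex (TorusSite 2 L) 2 → ℝ)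
    (hb : ∀ σ, b σ ≠ 0 → zerosCard σ = (Fintype.card (TorusSite 2 L) : ℝ) / 2 + M) :
    (fun τ => (b τ : ℂ)) ∈ spinZSector (Λ := TorusSite 2 L) 1 M := by
  refine (LiebMattis.mem_spinZSector_iff (Λ := TorusSite 2 L) 1 M _).2 fun σ hσ => ?_
  have hσ' : b σ ≠ 0 := by simpa using hσ
  have hz := hb σ hσ'
  have hones : (∑ x : TorusSite 2 L, ((σ x : ℕ) : ℝ)) = (Fintype.card (TorusSite 2 L) : ℝ) - zerosCard σ := by
    have h1 : ∀ x : TorusSite 2 L, ((σ x : ℕ) : ℝ) = 1 - (if σ x = 0 then (1:ℝ) else 0) := by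
      intro x; rcases fin2_cases₃ (σ x) with hx | hx <;> simp [hx]
    simp_rw [h1]
    rw [Finset.sum_sub_distrib, Finset.sum_const, Finset.card_univ, nsmul_eq_mul, mul_one]
    unfold zerosCard; rw [← Finset.sum_filter]; simp
  have hre : (∑ x : TorusSite 2 L, ((1 : ℝ) / 2 - (σ x : ℕ))) = M := by
    rw [Finset.sum_sub_distrib, Finset.sum_const, Finset.card_univ, nsmul_eq_mul, hones, hz]; ring
  have := congrArg (fun r : ℝ => (r : ℂ)) hre
  push_cast at this ⊢
  exact this

/-- Support of the flipped amplitude. [folklore] -/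
theorem flip_support {Δ M : ℝ} {a : TensorIndex (TorusSite 2 L) 2 → ℝ} (ha : IsPerronSectorGroundAmplitude L Δ M a) :
    ∀ σ, (a ∘ flipAll) σ ≠ 0 → zerosCard σ = (Fintype.card (TorusSite 2 L) : ℝ) / 2 + (-M) := by
  intro σ hσ
  have h := perron_support ha (flipAll σ) hσ
  rw [zerosCard_flipAll] at h
  linarith

/-- The amplitude-level energy is flip-invariant. [folklore] -/
theorem energy_flipAll (Δ : ℝ) (b : TensorIndex (TorusSite 2 L) 2 → ℝ) :
    ∑ σ, (b ∘ flipAll) σ * (fmOp (torusGraph 2 L) (b ∘ flipAll) σ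
        + (1 - Δ) * (isingW (torusGraph 2 L) σ * (b ∘ flipAll) σ))
      = ∑ σ, b σ * (fmOp (torusGraph 2 L) b σ + (1 - Δ) * (isingW (torusGraph 2 L) σ * b σ)) := by
  rw [← sum_flipAll (fun τ => b τ * (fmOp (torusGraph 2 L) b τ + (1 - Δ) * (isingW (torusGraph 2 L) τ * b τ)))]
  refine Finset.sum_congr rfl fun σ _ => ?_
  simp only [Function.comp_apply, fmOp_comp_flipAll, isingW_flipAll]

/-- `E(−M) ≤ E(M)` whenever the sector `M` carries a Perron amplitude. [folklore] -/
theorem lowestEnergy_neg_le {Δ M : ℝ} {a : TensorIndex (TorusSite 2 L) 2 → ℝ}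
    (ha : IsPerronSectorGroundAmplitude L Δ M a) :
    lowestEnergyInSector 1 (xxzHamiltonian 1 (torusGraph 2 L) (-1) Δ) (-M)
      ≤ lowestEnergyInSector 1 (xxzHamiltonian 1 (torusGraph 2 L) (-1) Δ) M := by
  have h := rayleigh_real Δ (-M) (a ∘ flipAll) (flip_support ha)
  rw [energy_flipAll, perron_energy_real ha] at h
  have hu : ∑ σ, (a ∘ flipAll) σ ^ 2 = 1 := by
    simp only [Function.comp_apply]; rw [sum_flipAll (fun τ => a τ ^ 2), ha.unit]
  rw [hu, mul_one] at h
  linarith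

/-- **PARTICLE–HOLE CONJUGATION OF PERRON AMPLITUDES:** if the sectors `M` and `−M` both carry Perron amplitudes, the
flip `a ∘ flipAll` of the sector-`M` one is a Perron amplitude of the sector `−M`. [folklore] -/
theorem isPerron_flipAll {Δ M : ℝ} {a b : TensorIndex (TorusSite 2 L) 2 → ℝ}
    (ha : IsPerronSectorGroundAmplitude L Δ M a) (hb : IsPerronSectorGroundAmplitude L Δ (-M) b) :
    IsPerronSectorGroundAmplitude L Δ (-M) (a ∘ flipAll) := by
  have hE : lowestEnergyInSector 1 (xxzHamiltonian 1 (torusGraph 2 L) (-1) Δ) (-M)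
      = lowestEnergyInSector 1 (xxzHamiltonian 1 (torusGraph 2 L) (-1) Δ) M := by
    refine le_antisymm (lowestEnergy_neg_le ha) ?_
    have := lowestEnergy_neg_le hb
    rwa [neg_neg] at this
  refine ⟨fun σ => ha.nonneg _, mem_spinZSector_of_support (-M) _ (flip_support ha), ?_, ?_⟩
  · simp only [Function.comp_apply]; rw [sum_flipAll (fun τ => a τ ^ 2), ha.unit]
  · funext σ
    rw [Pi.smul_apply, smul_eq_mul]
    have h1 := xxz_mulVec_real_apply (torusGraph 2 L) Δ (a ∘ flipAll) σ
    simp only [Function.comp_apply] at h1 ⊢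
    rw [h1, hE]
    have h2 := perron_eigen_real ha (flipAll σ)
    rw [← fmOp_comp_flipAll, isingW_flipAll] at h2
    have h2c := congrArg (fun r : ℝ => (r : ℂ)) h2
    push_cast at h2c ⊢
    linear_combination h2c

/-- **The Perron amplitude of `−M` is the flip of that of `M`.** [folklore] -/
theorem perron_neg_eq_flip {Δ M : ℝ} {a b : TensorIndex (TorusSite 2 L) 2 → ℝ}
    (ha : IsPerronSectorGroundAmplitude L Δ M a) (hb : IsPerronSectorGroundAmplitude L Δ (-M) b) :
    b = a ∘ flipAll :=
  perron_eq hb (isPerron_flipAll ha hb)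

end Torus

end Summit.HubbardSuperconductivity.HubbardSuperconductivity.Theorems.AnisotropyChord.Tower
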